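import Mathlib.NumberTheory.NumberField.Discriminant.Defs
import Mathlib.NumberTheory.PrimeCounting
import Literature.NumberTheory.LFunctions.EffectivePrimeIdealTheoremGRH
import Literature.NumberTheory.LFunctions.PrimeIdealChebyshev
import HarnessLib

/-!
# `π_ℚ(x) = π(x)`: the prime ideal count of `ℚ`, and the `K = ℚ` case of the GRH prime ideal theorem

Topic `Literature/NumberTheory/LFunctions`. Everything in this file is PROVED.

The effective prime ideal theorem under GRH is the named fact
`effectivePrimeIdealTheorem_of_ERH` (`EffectivePrimeIdealTheoremGRH.lean`; Serre 1981, Thm. 4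
(14_R), after Lagarias–Odlyzko 1977, Thm. 1.1). Its consumers (Bürgisser's Cor. 4.8 on primes with
a root of `g` modulo `p`, `Literature/Computability/AlgebraicComplexity/BurgisserRootCountGRH.lean`)
need to pass from `Li(x)` back to the rational prime count `π(x)`, i.e. the instance `K = ℚ` of
the fact, for which one must know that `π_ℚ(x) = primeIdealCount ℚ x` is the usual `π(⌊x⌋)`:

* `prime_absNorm_of_isPrime_rat` — a nonzero prime ideal of `𝓞 ℚ` has prime norm;
* `normPrimeIdealCount_rat` — Landau's `G(n)` for `K = ℚ` is the indicator of the primes;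
* `primeIdealCount_rat` — `π_ℚ(x) = π(⌊x⌋)` for `x ≥ 0`;
* `abs_primeCounting_sub_offsetLogIntegral_le_of_rat`,
  `abs_primeCounting_sub_offsetLogIntegral_le` — the `K = ℚ` instance of the GRH prime ideal
  theorem is von Koch's `|π(⌊x⌋) − Li(x)| ≤ c √x log x` (`d_ℚ = 1`, `n_ℚ = 1`; Serre 1981,
  p. 134, Remarque 2), with the same absolute constant `c`.

## References

* J.-P. Serre, *Quelques applications du théorème de densité de Chebotarev*, Publ. Math. IHÉS 54
  (1981), 123–201, §2.4, Théorème 4 and Remarque 2, pp. 133–134 (`Serre1981`).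
* J. Neukirch, *Algebraic Number Theory*, Springer 1999, VII §5, p. 457 (the ideals of `ℤ`).
-/

noncomputable section

open scoped NumberField
open Real Finset

namespace Literature.NumberTheory.LFunctions.NumberField

/-! ### The prime ideals of `𝓞 ℚ` -/

/-- A nonzero prime ideal of `𝓞 ℚ` has prime absolute norm: transported to `ℤ` along
`Rat.ringOfIntegersEquiv` it is `(q)` with `q = 𝔑(𝔭)` (`Int.ideal_span_absNorm_eq_self`), and
`(q) ⊂ ℤ` is a nonzero prime ideal exactly when `q` is a prime number. [folklore] -/
theorem prime_absNorm_of_isPrime_rat {P : Ideal (𝓞 ℚ)} (hP : P.IsPrime) (hP0 : P ≠ ⊥) :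
    (Ideal.absNorm P).Prime := by
  set J : Ideal ℤ := P.map (Rat.ringOfIntegersEquiv : 𝓞 ℚ →+* ℤ) with hJ
  have hJP : Ideal.absNorm J = Ideal.absNorm P := absNorm_map_ringOfIntegersEquiv P
  have hJspan : J = Ideal.span {((Ideal.absNorm P : ℕ) : ℤ)} := by
    rw [← hJP, Int.ideal_span_absNorm_eq_self]
  have hJprime : J.IsPrime := Ideal.map_isPrime_of_equiv _
  have hn0 : Ideal.absNorm P ≠ 0 := fun h => hP0 (Ideal.absNorm_eq_zero_iff.mp h)
  rw [hJspan, Ideal.span_singleton_prime (by exact_mod_cast hn0)] at hJprime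
  exact Int.prime_iff_natAbs_prime.mp hJprime

/-- In `𝓞 ℚ` there is exactly one prime ideal of each prime norm `p` and none of any other norm:
Landau's `G(n)` (`normPrimeIdealCount`) for `K = ℚ` is the indicator of the primes (the unique
ideal of norm `n` is `(n)`, `card_ideal_rat_absNorm_eq`; an ideal of prime norm is a nonzero prime
ideal). [folklore] -/
theorem normPrimeIdealCount_rat (n : ℕ) :
    normPrimeIdealCount ℚ n = if n.Prime then 1 else 0 := by
  split_ifs with hn
  · rw [normPrimeIdealCount, ← card_ideal_rat_absNorm_eq n, ← Nat.card_coe_set_eq]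
    refine Nat.card_congr (Equiv.subtypeEquivRight fun I => ?_)
    change I.IsPrime ∧ I ≠ ⊥ ∧ Ideal.absNorm I = n ↔ Ideal.absNorm I = n
    constructor
    · rintro ⟨-, -, h⟩
      exact h
    · intro hI
      refine ⟨Ideal.isPrime_of_irreducible_absNorm ?_, fun h0 => hn.ne_zero ?_, hI⟩
      · rw [hI]
        exact (Nat.irreducible_iff_nat_prime n).mpr hn
      · rw [← hI, h0]
        exact Ideal.absNorm_bot
  · rw [normPrimeIdealCount, Set.ncard_eq_zero (finite_setOf_prime_absNorm_eq ℚ n)]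
    ext P
    simp only [Set.mem_setOf_eq, Set.mem_empty_iff_false, iff_false, not_and]
    intro hP hP0 hPn
    exact hn (hPn ▸ prime_absNorm_of_isPrime_rat hP hP0)

/-- `π_ℚ(x) = π(⌊x⌋)`: the prime ideals of `𝓞 ℚ` of norm `≤ x` are the `(p)`, `p ≤ x` prime.
[folklore] -/
theorem primeIdealCount_rat {x : ℝ} (hx : 0 ≤ x) :
    primeIdealCount ℚ x = Nat.primeCounting ⌊x⌋₊ := by
  rw [primeIdealCount_eq_sum_normPrimeIdealCount ℚ hx, Nat.primeCounting, Nat.primeCounting',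
    Nat.count_eq_card_filter_range, card_eq_sum_ones, sum_filter]
  have h : range (⌊x⌋₊ + 1) = Icc 0 ⌊x⌋₊ := by
    ext n
    simp
  rw [h]
  exact sum_congr rfl fun n _ => normPrimeIdealCount_rat n

/-! ### The `K = ℚ` case of the effective prime ideal theorem under GRH -/

/-- The `K = ℚ` instance of the GRH prime ideal theorem is von Koch's bound
`|π(⌊x⌋) − Li(x)| ≤ c √x log x` (`d_ℚ = 1`, `n_ℚ = 1`; Serre 1981, p. 134, Remarque 2).
[cite: Serre1981, §2.4 Remarque 2 p. 134] -/
theorem abs_primeCounting_sub_offsetLogIntegral_le_of_rat {c : ℝ}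
    (H : ∀ x : ℝ, 2 ≤ x → |(primeIdealCount ℚ x : ℝ) - offsetLogIntegral x| ≤
      c * Real.sqrt x *
        (Real.log |(_root_.NumberField.discr ℚ : ℝ)| + Module.finrank ℚ ℚ * Real.log x))
    {x : ℝ} (hx : 2 ≤ x) :
    |(Nat.primeCounting ⌊x⌋₊ : ℝ) - offsetLogIntegral x| ≤ c * Real.sqrt x * Real.log x := by
  have h := H x hx
  rw [primeIdealCount_rat (by linarith), _root_.NumberField.discr_rat, Module.finrank_self] at h
  simpa using h

/-- Unpacking the body of `effectivePrimeIdealTheorem_of_ERH` at `K = ℚ` under the universal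
`Literature.NumberTheory.LFunctions.ExtendedRiemannHypothesis`: `|π(⌊x⌋) − Li(x)| ≤ c √x log x`
for `x ≥ 2`, with the same absolute constant `c` as for every other field (which is how
Bürgisser's Cor. 4.8 uses "the effective prime number theorem for `ℚ`", TCS 235 p. 83).
[cite: Serre1981, §2.4 Théorème 4 and Remarque 2 pp. 133–134] -/
theorem abs_primeCounting_sub_offsetLogIntegral_le {c : ℝ}
    (H : ∀ (K : Type) [Field K] [NumberField K], NumberField.ExtendedRiemannHypothesis K →
      ∀ x : ℝ, 2 ≤ x → |(primeIdealCount K x : ℝ) - offsetLogIntegral x| ≤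
        c * Real.sqrt x *
          (Real.log |(_root_.NumberField.discr K : ℝ)| + Module.finrank ℚ K * Real.log x))
    (hERH : Literature.NumberTheory.LFunctions.ExtendedRiemannHypothesis) {x : ℝ} (hx : 2 ≤ x) :
    |(Nat.primeCounting ⌊x⌋₊ : ℝ) - offsetLogIntegral x| ≤ c * Real.sqrt x * Real.log x :=
  abs_primeCounting_sub_offsetLogIntegral_le_of_rat (H ℚ (hERH ℚ)) hx

/-- From the named fact itself: under `effectivePrimeIdealTheorem_of_ERH` and the universal ERH
there is an absolute `c > 0` with `|π(⌊x⌋) − Li(x)| ≤ c √x log x` for all `x ≥ 2`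
(von Koch 1901 under RH; here as the `K = ℚ` case of Serre 1981, Thm. 4).
[cite: Serre1981, §2.4 Théorème 4 and Remarque 2 pp. 133–134] -/
theorem effectivePrimeIdealTheorem_of_ERH.primeCounting (h : effectivePrimeIdealTheorem_of_ERH)
    (hERH : Literature.NumberTheory.LFunctions.ExtendedRiemannHypothesis) :
    ∃ c : ℝ, 0 < c ∧ ∀ x : ℝ, 2 ≤ x →
      |(Nat.primeCounting ⌊x⌋₊ : ℝ) - offsetLogIntegral x| ≤ c * Real.sqrt x * Real.log x := by
  obtain ⟨c, hc, H⟩ := h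
  exact ⟨c, hc, fun x hx => abs_primeCounting_sub_offsetLogIntegral_le H hERH hx⟩

end Literature.NumberTheory.LFunctions.NumberField

end
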